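/-
Copyright (c) 2026 the pub-hodgecm-mathlib formalisation cell (harness21).  Prover seat hodgecm-mathlib-K2E1-p12 (g5), Track B ∕ K2-LIT, h413 = `stmt-HodgeConjecture-24833`,
R90-TF section S8 «ContSpec-n½», #4′ road, letter (β) (S8 dealer R90-CS-plan (g2), S8-R78 ∕ S8-R105 ∕ S8-R114 2026-09-04T23:19:21Z «=»): the (N_blk) clause of the LAYER 2 PRINT for the
OFF-DUAL blocks at the trivial right datum `ω = 1`, OUTRIGHT — an irreducible closed summand of `L²(U(J₂)_{L∕L⁺})` is orthogonal to the WHOLE off-dual block.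
-/
import Summits.HodgeConjecture.HodgeConjecture.Theorems.K2E1ResidualBlockPackageOffDualM1CMTwo          -- ★ p861419 FILE 1c (K2E4-p14): `offDual_block_package`, `m1_level_witness` (+ FILE 1b ∕ 1a ∕ 0: (y2) intertwining, model line, gauge Hecke operator)
import Summits.HodgeConjecture.HodgeConjecture.Theorems.K2E1BlockHeckeTBLetterFreeCMTwo                 -- ★ p860686 (K2E2-p12): `lpModel_blockProj_eq_zero_letterFree_two` (D5′ with only the model letters, `hTB` ★ inside)
import Summits.HodgeConjecture.HodgeConjecture.Theorems.K2E1BlockProjectorFixesVectorsU                 -- ★ (K2E2-p12): `cm_blockProjector_hPfix` (+ ★ `K2E1HeckeAlgebraLettersCM.cm_blockProjector_hPsa`)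
import Summits.HodgeConjecture.HodgeConjecture.Theorems.K2E1ArchTransposeKConjugateU2                   -- ★ p860595 (K2E2-p12): `antidiagonal_two_over_map ∕ _mul_self ∕ _map_embedding` (Mok's `J₂`)
import Summits.HodgeConjecture.HodgeConjecture.Theorems.K2E1MaximalLevelClosureArchFinCMTwo             -- ★ p861107 (K2E1-p12): `mem_unitaryOne_of_coe_mem_Kinf`, `closure_arch_fin_le_maximalLevel`
import Summits.HodgeConjecture.HodgeConjecture.Theorems.K2E1ChiSectionContinuousMaximalLevelCMTwo       -- ★ (K2E2-p12): `hVc_maximalLevel_one` (sections of `V(χ, K, 1)` are continuous)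
import Summits.HodgeConjecture.HodgeConjecture.Theorems.K2E1CuspidalSpectrumUnitaryDefs                 -- ★ `residualSubspace`
import Summits.HodgeConjecture.HodgeConjecture.Theorems.R90S8ResHBlockDataU2Defs                        -- ★ p862464 (K2E1-p15) H4″ DEFS: `resHBlock ∕ resHAtom ∕ resHLine`, `resHBlock_def`, `resHLine_le_resHBlock`
import HarnessLib

/-!
# S8 #4′ road, letter (β) — `R90S8ResHOffDualNoLineMassU2`: THE OFF-DUAL BLOCKS OF `L²(U(J₂)_{L∕L⁺})` CARRY NO DISCRETE MASS (the (N_blk) clause at `ω = 1`, OUTRIGHT)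

Track B ∕ R90-TF, crux h413 = `stmt-HodgeConjecture-24833`, route of record `HCCMUnconditional`; cell `hodgecm-mathlib`, section S8 «ContSpec-n½», socket #4′
`sock_S8_resH_spannedByCharLines` of `Lines/R90_S8_ResidualSpectrumU3B.lean`.  THEOREMS ONLY (no `def`, no `instance`, no `notation`, no named-fact hypothesis, no `sorry`; default
heartbeats); lane `--supports stmt-HodgeConjecture-24833 --as helper` (count-neutral).  CLOSES NO SOCKET: it pays the (N_blk) binder `hN` of ★ p862113
`residual_le_topologicalClosure_iSup_charLines_of_letters` (H7 ★ `resH_spannedByCharLines_of_letters_quasiSplit`) for ONE block type — the OFF-DUAL blocks `χ` (`χʷ ≁ χ`, i.e.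
`χ·(χʷ)⁻¹` not a norm twist) — at the rows of H7's index with TRIVIAL `K_∞`-type (`ω = 1`), OUTRIGHT modulo the E1 estate's structural binders; #4′ stays OPEN.

THE MATHEMATICS ([MoeglinWaldspurger1995, II.2.4, IV.1.10 (a rank-one cuspidal datum `χ` with `χʷ ≠ χ` contributes NO residual spectrum), IV.3.12, VI.2]; [ReedSimonI1980, Thm. II.3]).
Fix a unitary OFF-DUAL Hecke character `χ` of `L`, a section level `K_c ≤ K = K_∞·GL₂(𝒪̂_L)` and the `(K_c, 1)`-block `Sc = resHBlock K_c 1 χ` (closed span of the wave packets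
`[θ_{f,φ}]`, `f ∈ C_c((0,∞))`, `φ ∈ V(χ, K_c, 1)`).  The E1 estate proved (★ FILE 1c `offDual_block_package`, K2E4-p14): `Sc` is ISOMETRIC to `L²(ℝ × K_U)` through `V = (0, U_iso ∘ P_{Sc})`
(★ p860754, letter-free), the gauge Hecke operator `T = R_∞(a♮) ∘L R_f(e)` acts on `V_P = Fix(P)`, `P = P_1 ∘L R_f(e)`, through `V` by an `L^∞` symbol `σ(y) = s(½+iy)` (`s` entire,
non-constant; ★ (y2)), and `{σ = c}` is Lebesgue-null (★ `hline_model`).  ★ D5′ with only the model letters (`lpModel_blockProj_eq_zero_letterFree_two`, K2E2-p12; `hTB` ★ inside) then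
says: for every topologically irreducible closed `W′ ≤ L²` and `y ∈ W′`, **`V (P_{Sc} (P y)) = 0`**, hence `P_{Sc}(P y) = 0` (`V` is injective on `Sc`).  Since `P` is self-adjoint (★
`cm_blockProjector_hPsa`) and FIXES `Sc` (the wave packets are right-`K_c`-invariant, ★ `rightRegular_apply_brick_eq_self`; ★ `cm_blockProjector_hPfix`), for `v ∈ Sc`:
`⟪v, y⟫ = ⟪P v, y⟫ = ⟪v, P y⟫ = ⟪v, P_{Sc}(P y)⟫ + ⟪v, P y − P_{Sc}(P y)⟫ = 0`.  So **`W′ ⟂ Sc`**: the off-dual blocks carry no discrete (a fortiori no residual) mass, which is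
STRONGER than (N_blk) (`W′ ⊓ Iso(K_c, 1) ≤ W′`, `resHLine U′ ≤ resHBlock` for every block-model map `U′`).
* §1 **`subrep_le_orthogonal_resHBlock_offDual_one`** — general section level `K_c`: `W′.toSubmodule ≤ (resHBlock L μ K_c 1 χ)ᗮ`, modulo ★ FILE 1c's structural binders (measures
  `νinf νf μK μKU`, trivial `K_∞`-type `χ₁`, finite level `K′_f` with idempotent `e` and an open compact `U₀ ≤ GL₂(𝔸_{L,f})` cutting it out, `hKcK hKinfKc hU₀Kc`, `hVc`) + D5′'s `hestar`.
* §2 **`resH_isotypic_le_orthogonal_lines_offDual_one`** — THE `hN` BYTES of ★ p862113 at `(K′, ω, Ln) := (K_c, 1, resHLine L μ U′ K_c 1 χ)` for EVERY block-model map `U′` (§1).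
* §3 **`subrep_le_orthogonal_resHBlock_offDual_kad`** ∕ **`resH_isotypic_le_orthogonal_lines_offDual_kad`** — at H7's level family `K_c := Kad(K′_f) = ⟨ι_∞(K_∞) ∪ ι_f(K′_f)⟩` with
  `K′_f ⊆ GL₂(𝒪̂_L)`: `hKcK hKinfKc hU₀Kc` DISCHARGED (★ `closure_arch_fin_le_maximalLevel`, ★ `mem_unitaryOne_of_coe_mem_Kinf`).
* §4 **`subrep_le_orthogonal_resHBlock_offDual_maximalLevel`** ∕ **`resH_isotypic_le_orthogonal_lines_offDual_maximalLevel`** — M1 (`K_c := K`, `K′_f := GL₂(𝒪̂_L) ∩ G_f`):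
  every structural binder DISCHARGED (★ `m1_level_witness`, ★ `hVc_maximalLevel_one`, Haar measure on the compact `K_U`) — visible only the measures `νinf νf μK`, `χ₁ ≡ 1` and `e`.
NOT COVERED (honest): rows with `ω ≠ 1` (non-trivial `K_∞`-type ∕ finite character) — ★ FILE 1a's off-dual Hecke operator is built at the trivial `K_∞`-type only; self-dual blocks.
HONEST LABEL: HC_CM is proved only modulo the 7 printed citations (2 remaining named inputs: hLiu418 = `stmt-HodgeConjecture-24832`, h413 = `stmt-HodgeConjecture-24833`) until
rung 0 closes; REL ≠ ★ ≠ BUILT; this file asserts no named fact, is conditional by construction on its visible structural binders, and closes no socket; count-neutral.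

## References
* [MoeglinWaldspurger1995] C. Mœglin, J.-L. Waldspurger, *Spectral Decomposition and Eisenstein Series* (1995), II.2.4, IV.1.10, IV.3.12, V.3.13, VI.2.
* [ReedSimonI1980] M. Reed, B. Simon, *Methods of Modern Mathematical Physics I* (1980), Thm. II.3, §VII.2.
* [BorelJacquet1979] A. Borel, H. Jacquet, *Automorphic forms and automorphic representations*, PSPM 33.1 (1979), §4.1, §4.6.
* [Knapp1986] A. W. Knapp, *Representation Theory of Semisimple Groups* (1986), VIII §3.
-/

set_option autoImplicit false
set_option linter.dupNamespace false  -- the mandated namespace `…HodgeConjecture.HodgeConjecture.R90.S8` (LEAD #1 L1) repeats the summit's segment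

noncomputable section

open MeasureTheory MeasureTheory.Measure Filter Topology CompactlySupported NumberField NumberField.mixedEmbedding NumberField.InfinitePlace IsDedekindDomain Set Complex
open scoped ENNReal NNReal ComplexConjugate InnerProductSpace
open Literature.NumberTheory Literature.NumberTheory.Automorphic Literature.NumberTheory.Automorphic.UnitaryGroup Literature.NumberTheory.GaloisRepresentations AdelicGroupData ContRepresentation
open Summit.HodgeConjecture.HodgeConjecture.Cruxes.H413.K2E1BorelEisensteinU
open Summit.HodgeConjecture.HodgeConjecture.Cruxes.H413.K2E1CharacterEisensteinU2Defs
open Summit.HodgeConjecture.HodgeConjecture.Cruxes.H413.K2E1ChiSectionSpaceU2Defs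
open Summit.HodgeConjecture.HodgeConjecture.Cruxes.H413.K2E1CuspidalSpectrumUnitary (residualSubspace)
open Summit.HodgeConjecture.HodgeConjecture.Cruxes.H413.K2E1ResidualBlockPackageOffDualM1CMTwo (offDual_block_package m1_level_witness)
open Summit.HodgeConjecture.HodgeConjecture.Cruxes.H413.K2E1ResidualBlockPackageOffDualHeckeCMTwo (rightRegular_apply_brick_eq_self apply_eq_self_of_mem_topologicalClosure_span)
open Summit.HodgeConjecture.HodgeConjecture.Cruxes.H413.K2E1BlockHeckeTBLetterFreeCMTwo (lpModel_blockProj_eq_zero_letterFree_two)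
open Summit.HodgeConjecture.HodgeConjecture.Cruxes.H413.K2E1BlockProjectorFixesVectorsU (cm_blockProjector_hPfix)
open Summit.HodgeConjecture.HodgeConjecture.Cruxes.H413.K2E1HeckeAlgebraLettersCM (cm_blockProjector_hPsa)
open Summit.HodgeConjecture.HodgeConjecture.Cruxes.H413.K2E1ArchTransposeKConjugateU2 (antidiagonal_two_over_map antidiagonal_two_over_mul_self antidiagonal_two_over_map_embedding)
open Summit.HodgeConjecture.HodgeConjecture.Cruxes.H413.K2E1MaximalLevelClosureArchFinCMTwo (mem_unitaryOne_of_coe_mem_Kinf closure_arch_fin_le_maximalLevel)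
open Summit.HodgeConjecture.HodgeConjecture.Cruxes.H413.K2E1ChiSectionContinuousMaximalLevelCMTwo (hVc_maximalLevel_one)
open Summit.HodgeConjecture.HodgeConjecture.Cruxes.H413.K2E1MaximalLevelHeckePureTensorBridgeCMTwo (adelicVal_archToAdelic_inclusion_mem_standardMaximalCompactGL)

namespace Summit.HodgeConjecture.HodgeConjecture.R90.S8

variable (L : Type) [Field L] [NumberField L] [IsCMField L]
  [MeasurableSpace (quasiSplit (↥(maximalRealSubfield L)) L (IsCMField.complexConj L) 2).Adelic] [BorelSpace (quasiSplit (↥(maximalRealSubfield L)) L (IsCMField.complexConj L) 2).Adelic]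
  (μ : Measure (quasiSplit (↥(maximalRealSubfield L)) L (IsCMField.complexConj L) 2).automorphicQuotient) [(quasiSplit (↥(maximalRealSubfield L)) L (IsCMField.complexConj L) 2).IsAutomorphicMeasure μ]
  [MeasurableSpace (UnitaryGroup.arch (↥(maximalRealSubfield L)) L (IsCMField.complexConj L) 2 ((StdForm.antidiagonal 2).over L))] [BorelSpace (UnitaryGroup.arch (↥(maximalRealSubfield L)) L (IsCMField.complexConj L) 2 ((StdForm.antidiagonal 2).over L))]
  [MeasurableSpace (finAdelic (↥(maximalRealSubfield L)) L (IsCMField.complexConj L) 2 ((StdForm.antidiagonal 2).over L))] [BorelSpace (finAdelic (↥(maximalRealSubfield L)) L (IsCMField.complexConj L) 2 ((StdForm.antidiagonal 2).over L))]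
  (νinf : Measure (UnitaryGroup.arch (↥(maximalRealSubfield L)) L (IsCMField.complexConj L) 2 ((StdForm.antidiagonal 2).over L))) [IsHaarMeasure νinf] [νinf.IsInvInvariant] [SFinite νinf]
  (νf : Measure (finAdelic (↥(maximalRealSubfield L)) L (IsCMField.complexConj L) 2 ((StdForm.antidiagonal 2).over L))) [IsFiniteMeasureOnCompacts νf] [νf.IsMulLeftInvariant] [νf.IsInvInvariant] [νf.IsOpenPosMeasure]
  [MeasurableSpace ↥(UnitaryGroup.arch (↥(maximalRealSubfield L)) L (IsCMField.complexConj L) 2 ((StdForm.antidiagonal 2).over L) ⊓ unitaryGroupOfForm (conjMixed (↥(maximalRealSubfield L)) L (IsCMField.complexConj L)) 1)] [BorelSpace ↥(UnitaryGroup.arch (↥(maximalRealSubfield L)) L (IsCMField.complexConj L) 2 ((StdForm.antidiagonal 2).over L) ⊓ unitaryGroupOfForm (conjMixed (↥(maximalRealSubfield L)) L (IsCMField.complexConj L)) 1)]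
  (μK : Measure ↥(UnitaryGroup.arch (↥(maximalRealSubfield L)) L (IsCMField.complexConj L) 2 ((StdForm.antidiagonal 2).over L) ⊓ unitaryGroupOfForm (conjMixed (↥(maximalRealSubfield L)) L (IsCMField.complexConj L)) 1)) [IsProbabilityMeasure μK] [μK.IsMulLeftInvariant] [μK.IsMulRightInvariant] [μK.IsInvInvariant]
  (χ₁ : C_c(↥(UnitaryGroup.arch (↥(maximalRealSubfield L)) L (IsCMField.complexConj L) 2 ((StdForm.antidiagonal 2).over L) ⊓ unitaryGroupOfForm (conjMixed (↥(maximalRealSubfield L)) L (IsCMField.complexConj L)) 1), ℂ)) (e : C_c(finAdelic (↥(maximalRealSubfield L)) L (IsCMField.complexConj L) 2 ((StdForm.antidiagonal 2).over L), ℂ))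

/-! ## §1 General section level `K_c`: an irreducible closed `W′ ≤ L²` is orthogonal to the whole off-dual block `resHBlock K_c 1 χ` -/

set_option maxHeartbeats 400000 in
include νinf μK in
/-- **THE OFF-DUAL BLOCK CARRIES NO DISCRETE MASS (general section level `K_c`).**  Frame: `G = U(J₂)` over `L∕L⁺`, `K_∞ = G(L⁺ ⊗ ℝ) ∩ U(1 ⊗ 1)` (`κ` the inclusion), the TRIVIAL
`K_∞`-type `χ₁ ≡ 1`, a finite level `K′_f = U₀ ∩ G(𝔸_f)` (`U₀ ≤ GL₂(𝔸_{L,f})` open compact) with its normalised idempotent `e` (`e* = e`), a section level `K_c ≤ K` with `ι_∞(K_∞) ∩ K ⊆ K_c`,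
`ι_f(K′_f) ⊆ K_c` and continuous sections, a probability Haar measure on `K_∞`, Haar data `ν_∞, ν_f` and a Haar measure `μ_{K_U}` on `K_U`.  THEN for every UNITARY OFF-DUAL Hecke character
`χ` (`χ·(χʷ)⁻¹` not a norm twist) and every topologically irreducible closed `W′ ≤ L²(G(L⁺)∖G(𝔸_{L⁺}), μ)`: **`W′ ⟂ resHBlock L μ K_c 1 χ`**.  Proof: ★ `offDual_block_package` at `gen :=` the
wave packets of the block; ★ `lpModel_blockProj_eq_zero_letterFree_two` ⇒ `V (P_{Sc}(P y)) = 0` ⇒ `P_{Sc}(P y) = 0` (`hV`); `P` fixes `Sc` (★ `rightRegular_apply_brick_eq_self`,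
★ `cm_blockProjector_hPfix`) and is self-adjoint (★ `cm_blockProjector_hPsa`) ⇒ `⟪v, y⟫ = ⟪v, P y⟫ = 0`.
[cite: MoeglinWaldspurger1995, IV.1.10, IV.3.12, VI.2] [cite: ReedSimonI1980, Thm. II.3] [cite: Knapp1986, VIII §3] -/
theorem subrep_le_orthogonal_resHBlock_offDual_one [MeasurableMul (finAdelic (↥(maximalRealSubfield L)) L (IsCMField.complexConj L) 2 ((StdForm.antidiagonal 2).over L))] [ENNReal.HolderTriple ∞ 2 2] (hχ1 : ∀ k, χ₁ k = 1)
    (K' : Subgroup (finAdelic (↥(maximalRealSubfield L)) L (IsCMField.complexConj L) 2 ((StdForm.antidiagonal 2).over L))) (hK'o : IsOpen (K' : Set (finAdelic (↥(maximalRealSubfield L)) L (IsCMField.complexConj L) 2 ((StdForm.antidiagonal 2).over L))))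
    (he0 : ∀ x, x ∉ K' → e x = 0) (he1 : ∫ x, e x ∂νf = 1) (heK : ∀ k ∈ K', ∀ x, e (k * x) = e x) (hestar : ∀ x, mulStar (⇑e) x = e x)
    (U₀ : Subgroup (GL (Fin 2) (FiniteAdeleRing (𝓞 L) L))) (hU₀o : IsOpen (U₀ : Set (GL (Fin 2) (FiniteAdeleRing (𝓞 L) L)))) (hU₀c : IsCompact (U₀ : Set (GL (Fin 2) (FiniteAdeleRing (𝓞 L) L))))
    (hK'U₀ : ∀ b : finAdelic (↥(maximalRealSubfield L)) L (IsCMField.complexConj L) 2 ((StdForm.antidiagonal 2).over L), b ∈ K' ↔ (b : GL (Fin 2) (FiniteAdeleRing (𝓞 L) L)) ∈ U₀)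
    {Kc : Subgroup (quasiSplit (↥(maximalRealSubfield L)) L (IsCMField.complexConj L) 2).Adelic} (hKcK : Kc ≤ ((standardMaximalCompactGL 2 L).comap (adelicVal (↥(maximalRealSubfield L)) L (IsCMField.complexConj L) 2 ((StdForm.antidiagonal 2).over L)) : Subgroup (quasiSplit (↥(maximalRealSubfield L)) L (IsCMField.complexConj L) 2).Adelic))
    (hKinfKc : ∀ k : UnitaryGroup.arch (↥(maximalRealSubfield L)) L (IsCMField.complexConj L) 2 ((StdForm.antidiagonal 2).over L), (adelicVal (↥(maximalRealSubfield L)) L (IsCMField.complexConj L) 2 ((StdForm.antidiagonal 2).over L)) ((archToAdelic (↥(maximalRealSubfield L)) L (IsCMField.complexConj L) 2 ((StdForm.antidiagonal 2).over L)) k) ∈ standardMaximalCompactGL 2 L → (archToAdelic (↥(maximalRealSubfield L)) L (IsCMField.complexConj L) 2 ((StdForm.antidiagonal 2).over L)) k ∈ Kc)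
    (hU₀Kc : ∀ b : finAdelic (↥(maximalRealSubfield L)) L (IsCMField.complexConj L) 2 ((StdForm.antidiagonal 2).over L), (b : GL (Fin 2) (FiniteAdeleRing (𝓞 L) L)) ∈ U₀ → (finAdelicToAdelic (↥(maximalRealSubfield L)) L (IsCMField.complexConj L) 2 ((StdForm.antidiagonal 2).over L)) b ∈ Kc)
    (μKU : Measure ↥((standardMaximalCompactGL 2 L).comap (adelicVal (↥(maximalRealSubfield L)) L (IsCMField.complexConj L) 2 ((StdForm.antidiagonal 2).over L)) : Subgroup (quasiSplit (↥(maximalRealSubfield L)) L (IsCMField.complexConj L) 2).Adelic)) [μKU.IsHaarMeasure]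
    {χ : HeckeCharacter L} (hχu : χ.IsUnitary) (hoff : ¬ (χ * (reflectChar (IsCMField.complexConj L) χ)⁻¹).IsNormTwist)
    (hVc : ∀ φ ∈ chiSectionSpace χ Kc 1, Continuous φ) :
    ∀ W' : ClosedSubrep ((quasiSplit (↥(maximalRealSubfield L)) L (IsCMField.complexConj L) 2).rightRegular μ), W'.toContRep.IsTopIrreducible → W'.toSubmodule ≤ (resHBlock L μ Kc 1 χ)ᗮ := by
  intro W' hW' y hy
  -- the block projector `P = P_1 ∘L R_f(e)` (a term of this proof, not a binder)
  obtain ⟨P, hPdef⟩ : ∃ P : (quasiSplit (↥(maximalRealSubfield L)) L (IsCMField.complexConj L) 2).L2 μ →L[ℂ] (quasiSplit (↥(maximalRealSubfield L)) L (IsCMField.complexConj L) 2).L2 μ, P = ((((quasiSplit (↥(maximalRealSubfield L)) L (IsCMField.complexConj L) 2).rightRegular μ).restrict ((archToAdelic (↥(maximalRealSubfield L)) L (IsCMField.complexConj L) 2 ((StdForm.antidiagonal 2).over L)).comp (Subgroup.inclusion (inf_le_left : UnitaryGroup.arch (↥(maximalRealSubfield L)) L (IsCMField.complexConj L) 2 ((StdForm.antidiagonal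 2).over L) ⊓ unitaryGroupOfForm (conjMixed (↥(maximalRealSubfield L)) L (IsCMField.complexConj L)) 1 ≤ UnitaryGroup.arch (↥(maximalRealSubfield L)) L (IsCMField.complexConj L) 2 ((StdForm.antidiagonal 2).over L))))).integratedOperator (((quasiSplit (↥(maximalRealSubfield L)) L (IsCMField.complexConj L) 2).isUnitary_rightRegular μ).restrict _) (((quasiSplit (↥(maximalRealSubfield L)) L (IsCMField.complexConj L) 2).isStronglyContinuous_rightRegular_holds μ).restrict _ ((continuous_archToAdelic (↥(maximalRealSubfield L)) L (IsCMField.complexConj L) 2 ((StdForm.antidiagonal 2).over L)).comp (continuous_induced_rng.2 continuous_subtype_val))) μK χ₁ ∘L (((quasiSplit (↥(maximalRealSubfield L)) L (IsCMField.complexConj L) 2).rightRegular μ).restrict (finAdelicToAdelic (↥(maximalRealSubfield L)) L (IsCMField.complexConj L) 2 ((StdForm.antidiagonal 2).over L))).integratedOperator (((quasiSplit (↥(maximalRealSubfield L)) L (IsCMField.complexConj L) 2).isUnitary_rightRegular μ).restrict _) (((quasiSplit (↥(maximalRealSubfield L)) L (IsCMField.complexConj L) 2).isStronglyContinuous_rightRegular_holds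 μ).restrict _ (continuous_finAdelicToAdelic (↥(maximalRealSubfield L)) L (IsCMField.complexConj L) 2 ((StdForm.antidiagonal 2).over L))) νf e) := ⟨_, rfl⟩
  -- ★ FILE 1c: the off-dual per-block package at `gen :=` the wave packets of the block
  obtain ⟨V, h, s, hs, hhl, hhr, hU, hline, hVinj⟩ := offDual_block_package L μ νinf νf μK χ₁ e μKU hχ1 K' hK'o he0 he1 heK P hPdef U₀ hU₀o hU₀c hK'U₀ hKcK hKinfKc hU₀Kc hχu hoff hVc
    {v : (quasiSplit (↥(maximalRealSubfield L)) L (IsCMField.complexConj L) 2).L2 μ |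
        ∃ (f : ℝ → ℂ) (_ : Continuous f) (_ : HasCompactSupport f) (_ : tsupport f ⊆ Ioi 0)
          (φ : (quasiSplit (↥(maximalRealSubfield L)) L (IsCMField.complexConj L) 2).Adelic → ℂ) (_ : φ ∈ chiSectionSpace χ Kc ((1 : ↥Kc →* ℂ) : ↥Kc → ℂ)) (_ : Continuous φ)
          (hv : MemLp ((quasiSplit (↥(maximalRealSubfield L)) L (IsCMField.complexConj L) 2).quotFun (eisensteinSeriesU (fun g => f (borelHeight g) * φ g))) 2 μ), v = hv.toLp _} rfl
  -- the block IS `closure span` of that set (★ `resHBlock_def`, `rfl`)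
  have hSc : resHBlock L μ Kc 1 χ = (Submodule.span ℂ {v : (quasiSplit (↥(maximalRealSubfield L)) L (IsCMField.complexConj L) 2).L2 μ |
        ∃ (f : ℝ → ℂ) (_ : Continuous f) (_ : HasCompactSupport f) (_ : tsupport f ⊆ Ioi 0)
          (φ : (quasiSplit (↥(maximalRealSubfield L)) L (IsCMField.complexConj L) 2).Adelic → ℂ) (_ : φ ∈ chiSectionSpace χ Kc ((1 : ↥Kc →* ℂ) : ↥Kc → ℂ)) (_ : Continuous φ)
          (hv : MemLp ((quasiSplit (↥(maximalRealSubfield L)) L (IsCMField.complexConj L) 2).quotFun (eisensteinSeriesU (fun g => f (borelHeight g) * φ g))) 2 μ), v = hv.toLp _}).topologicalClosure := rfl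
  haveI : CompleteSpace ↥(Submodule.span ℂ {v : (quasiSplit (↥(maximalRealSubfield L)) L (IsCMField.complexConj L) 2).L2 μ |
        ∃ (f : ℝ → ℂ) (_ : Continuous f) (_ : HasCompactSupport f) (_ : tsupport f ⊆ Ioi 0)
          (φ : (quasiSplit (↥(maximalRealSubfield L)) L (IsCMField.complexConj L) 2).Adelic → ℂ) (_ : φ ∈ chiSectionSpace χ Kc ((1 : ↥Kc →* ℂ) : ↥Kc → ℂ)) (_ : Continuous φ)
          (hv : MemLp ((quasiSplit (↥(maximalRealSubfield L)) L (IsCMField.complexConj L) 2).quotFun (eisensteinSeriesU (fun g => f (borelHeight g) * φ g))) 2 μ), v = hv.toLp _}).topologicalClosure := (Submodule.isClosed_topologicalClosure _).completeSpace_coe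
  have hχmul : ∀ k l, χ₁ (k * l) = χ₁ k * χ₁ l := fun k l => by rw [hχ1, hχ1, hχ1, one_mul]
  have hχinv : ∀ k, conj (χ₁ k⁻¹) = χ₁ k := fun k => by rw [hχ1, hχ1, map_one]
  -- ★ D5′ (letter-free, N = 2): the line coordinate of `P y` vanishes
  have hD5 : ((V ∘ₗ (((Submodule.span ℂ {v : (quasiSplit (↥(maximalRealSubfield L)) L (IsCMField.complexConj L) 2).L2 μ |
        ∃ (f : ℝ → ℂ) (_ : Continuous f) (_ : HasCompactSupport f) (_ : tsupport f ⊆ Ioi 0)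
          (φ : (quasiSplit (↥(maximalRealSubfield L)) L (IsCMField.complexConj L) 2).Adelic → ℂ) (_ : φ ∈ chiSectionSpace χ Kc ((1 : ↥Kc →* ℂ) : ↥Kc → ℂ)) (_ : Continuous φ)
          (hv : MemLp ((quasiSplit (↥(maximalRealSubfield L)) L (IsCMField.complexConj L) 2).quotFun (eisensteinSeriesU (fun g => f (borelHeight g) * φ g))) 2 μ), v = hv.toLp _}).topologicalClosure.starProjection : (quasiSplit (↥(maximalRealSubfield L)) L (IsCMField.complexConj L) 2).L2 μ →L[ℂ] (quasiSplit (↥(maximalRealSubfield L)) L (IsCMField.complexConj L) 2).L2 μ).toLinearMap)) (P y)).2 = 0 :=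
    lpModel_blockProj_eq_zero_letterFree_two ((StdForm.antidiagonal 2).over L) ((quasiSplit (↥(maximalRealSubfield L)) L (IsCMField.complexConj L) 2).rightRegular μ) ((quasiSplit (↥(maximalRealSubfield L)) L (IsCMField.complexConj L) 2).isUnitary_rightRegular μ) ((quasiSplit (↥(maximalRealSubfield L)) L (IsCMField.complexConj L) 2).isStronglyContinuous_rightRegular_holds μ) νinf νf μK χ₁ e
      (antidiagonal_two_over_map (↥(maximalRealSubfield L)) L (IsCMField.complexConj L)) (antidiagonal_two_over_mul_self L) (antidiagonal_two_over_map_embedding L)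
      hχmul (hχ1 1) hχinv K' he0 he1 heK hestar P hPdef W' hW' h hhl hhr
      ((LinearMap.snd ℂ PUnit.{1} (Lp ℂ 2 ((volume : Measure ℝ).prod μKU))).comp (V ∘ₗ (((Submodule.span ℂ {v : (quasiSplit (↥(maximalRealSubfield L)) L (IsCMField.complexConj L) 2).L2 μ |
        ∃ (f : ℝ → ℂ) (_ : Continuous f) (_ : HasCompactSupport f) (_ : tsupport f ⊆ Ioi 0)
          (φ : (quasiSplit (↥(maximalRealSubfield L)) L (IsCMField.complexConj L) 2).Adelic → ℂ) (_ : φ ∈ chiSectionSpace χ Kc ((1 : ↥Kc →* ℂ) : ↥Kc → ℂ)) (_ : Continuous φ)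
          (hv : MemLp ((quasiSplit (↥(maximalRealSubfield L)) L (IsCMField.complexConj L) 2).quotFun (eisensteinSeriesU (fun g => f (borelHeight g) * φ g))) 2 μ), v = hv.toLp _}).topologicalClosure.starProjection : (quasiSplit (↥(maximalRealSubfield L)) L (IsCMField.complexConj L) 2).L2 μ →L[ℂ] (quasiSplit (↥(maximalRealSubfield L)) L (IsCMField.complexConj L) 2).L2 μ).toLinearMap))) s hs
      (fun j v hv => hU j v hv) hline hy
  -- hence `P_{Sc}(P y) = 0` (`V` has `PUnit` first coordinate and is injective on the block)
  have hproj0 : (Submodule.span ℂ {v : (quasiSplit (↥(maximalRealSubfield L)) L (IsCMField.complexConj L) 2).L2 μ |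
        ∃ (f : ℝ → ℂ) (_ : Continuous f) (_ : HasCompactSupport f) (_ : tsupport f ⊆ Ioi 0)
          (φ : (quasiSplit (↥(maximalRealSubfield L)) L (IsCMField.complexConj L) 2).Adelic → ℂ) (_ : φ ∈ chiSectionSpace χ Kc ((1 : ↥Kc →* ℂ) : ↥Kc → ℂ)) (_ : Continuous φ)
          (hv : MemLp ((quasiSplit (↥(maximalRealSubfield L)) L (IsCMField.complexConj L) 2).quotFun (eisensteinSeriesU (fun g => f (borelHeight g) * φ g))) 2 μ), v = hv.toLp _}).topologicalClosure.starProjection (P y) = 0 := by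
    refine hVinj _ (Submodule.starProjection_apply_mem _ _) (Prod.ext (Subsingleton.elim _ _) ?_)
    simpa only [LinearMap.comp_apply, ContinuousLinearMap.coe_coe, Prod.snd_zero] using hD5
  -- `P` fixes the block: every wave packet is right-`K_c`-invariant, `ι_f(K′_f) ∪ ι_∞(K_∞) ⊆ K_c`
  have hfixR : ∀ g ∈ Kc, ∀ t ∈ (Submodule.span ℂ {v : (quasiSplit (↥(maximalRealSubfield L)) L (IsCMField.complexConj L) 2).L2 μ |
        ∃ (f : ℝ → ℂ) (_ : Continuous f) (_ : HasCompactSupport f) (_ : tsupport f ⊆ Ioi 0)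
          (φ : (quasiSplit (↥(maximalRealSubfield L)) L (IsCMField.complexConj L) 2).Adelic → ℂ) (_ : φ ∈ chiSectionSpace χ Kc ((1 : ↥Kc →* ℂ) : ↥Kc → ℂ)) (_ : Continuous φ)
          (hv : MemLp ((quasiSplit (↥(maximalRealSubfield L)) L (IsCMField.complexConj L) 2).quotFun (eisensteinSeriesU (fun g => f (borelHeight g) * φ g))) 2 μ), v = hv.toLp _}).topologicalClosure, ((quasiSplit (↥(maximalRealSubfield L)) L (IsCMField.complexConj L) 2).rightRegular μ) g t = t := fun g hg =>
    apply_eq_self_of_mem_topologicalClosure_span (((quasiSplit (↥(maximalRealSubfield L)) L (IsCMField.complexConj L) 2).rightRegular μ) g : (quasiSplit (↥(maximalRealSubfield L)) L (IsCMField.complexConj L) 2).L2 μ →L[ℂ] (quasiSplit (↥(maximalRealSubfield L)) L (IsCMField.complexConj L) 2).L2 μ) (by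
      rintro t ⟨f, -, -, -, φ, hφ, -, hv, rfl⟩
      exact rightRegular_apply_brick_eq_self L μ hKcK hφ hv hg)
  have hKinfKc' : ∀ k : ↥(UnitaryGroup.arch (↥(maximalRealSubfield L)) L (IsCMField.complexConj L) 2 ((StdForm.antidiagonal 2).over L) ⊓ unitaryGroupOfForm (conjMixed (↥(maximalRealSubfield L)) L (IsCMField.complexConj L)) 1), (archToAdelic (↥(maximalRealSubfield L)) L (IsCMField.complexConj L) 2 ((StdForm.antidiagonal 2).over L)) ((Subgroup.inclusion (inf_le_left : UnitaryGroup.arch (↥(maximalRealSubfield L)) L (IsCMField.complexConj L) 2 ((StdForm.antidiagonal 2).over L) ⊓ unitaryGroupOfForm (conjMixed (↥(maximalRealSubfield L)) L (IsCMField.complexConj L)) 1 ≤ UnitaryGroup.arch (↥(maximalRealSubfield L)) L (IsCMField.complexConj L) 2 ((StdForm.antidiagonal 2).over L))) k) ∈ Kc := fun k =>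
    hKinfKc _ (adelicVal_archToAdelic_inclusion_mem_standardMaximalCompactGL k)
  have hPfix : ∀ t ∈ (Submodule.span ℂ {v : (quasiSplit (↥(maximalRealSubfield L)) L (IsCMField.complexConj L) 2).L2 μ |
        ∃ (f : ℝ → ℂ) (_ : Continuous f) (_ : HasCompactSupport f) (_ : tsupport f ⊆ Ioi 0)
          (φ : (quasiSplit (↥(maximalRealSubfield L)) L (IsCMField.complexConj L) 2).Adelic → ℂ) (_ : φ ∈ chiSectionSpace χ Kc ((1 : ↥Kc →* ℂ) : ↥Kc → ℂ)) (_ : Continuous φ)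
          (hv : MemLp ((quasiSplit (↥(maximalRealSubfield L)) L (IsCMField.complexConj L) 2).quotFun (eisensteinSeriesU (fun g => f (borelHeight g) * φ g))) 2 μ), v = hv.toLp _}).topologicalClosure, P t = t := by
    intro t ht
    rw [hPdef]
    refine cm_blockProjector_hPfix ((quasiSplit (↥(maximalRealSubfield L)) L (IsCMField.complexConj L) 2).rightRegular μ) ((quasiSplit (↥(maximalRealSubfield L)) L (IsCMField.complexConj L) 2).isUnitary_rightRegular μ) ((quasiSplit (↥(maximalRealSubfield L)) L (IsCMField.complexConj L) 2).isStronglyContinuous_rightRegular_holds μ) νf (Subgroup.inclusion (inf_le_left : UnitaryGroup.arch (↥(maximalRealSubfield L)) L (IsCMField.complexConj L) 2 ((StdForm.antidiagonal 2).over L) ⊓ unitaryGroupOfForm (conjMixed (↥(maximalRealSubfield L)) L (IsCMField.complexConj L)) 1 ≤ UnitaryGroup.arch (↥(maximalRealSubfield L)) L (IsCMField.complexConj L) 2 ((StdForm.antidiagonal 2).over L))) (continuous_induced_rng.2 continuous_subtype_val) μK χ₁ e hχmul (hχ1 1) K' he0 he1 t (fun u hu => ?_) (fun k => ?_)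
    · exact hfixR _ (hU₀Kc u ((hK'U₀ u).1 hu)) t ht
    · rw [hχ1, one_smul]
      exact hfixR _ (hKinfKc' k) t ht
  -- `P` is self-adjoint
  have hPsa : ∀ x z : (quasiSplit (↥(maximalRealSubfield L)) L (IsCMField.complexConj L) 2).L2 μ, ⟪P x, z⟫_ℂ = ⟪x, P z⟫_ℂ := fun x z => by
    rw [hPdef]
    exact cm_blockProjector_hPsa ((quasiSplit (↥(maximalRealSubfield L)) L (IsCMField.complexConj L) 2).rightRegular μ) ((quasiSplit (↥(maximalRealSubfield L)) L (IsCMField.complexConj L) 2).isUnitary_rightRegular μ) ((quasiSplit (↥(maximalRealSubfield L)) L (IsCMField.complexConj L) 2).isStronglyContinuous_rightRegular_holds μ) νf (Subgroup.inclusion (inf_le_left : UnitaryGroup.arch (↥(maximalRealSubfield L)) L (IsCMField.complexConj L) 2 ((StdForm.antidiagonal 2).over L) ⊓ unitaryGroupOfForm (conjMixed (↥(maximalRealSubfield L)) L (IsCMField.complexConj L)) 1 ≤ UnitaryGroup.arch (↥(maximalRealSubfield L)) L (IsCMField.complexConj L) 2 ((StdForm.antidiagonal 2).over L))) (continuous_induced_rng.2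 continuous_subtype_val) μK χ₁ e hχinv hestar x z
  -- conclude: `⟪v, y⟫ = ⟪P v, y⟫ = ⟪v, P y⟫ = ⟪v, P_{Sc}(P y)⟫ + ⟪v, P y − P_{Sc}(P y)⟫ = 0`
  rw [Submodule.mem_orthogonal]
  intro v hv
  rw [hSc] at hv
  have h2 : ⟪v, P y - (Submodule.span ℂ {v : (quasiSplit (↥(maximalRealSubfield L)) L (IsCMField.complexConj L) 2).L2 μ |
        ∃ (f : ℝ → ℂ) (_ : Continuous f) (_ : HasCompactSupport f) (_ : tsupport f ⊆ Ioi 0)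
          (φ : (quasiSplit (↥(maximalRealSubfield L)) L (IsCMField.complexConj L) 2).Adelic → ℂ) (_ : φ ∈ chiSectionSpace χ Kc ((1 : ↥Kc →* ℂ) : ↥Kc → ℂ)) (_ : Continuous φ)
          (hv : MemLp ((quasiSplit (↥(maximalRealSubfield L)) L (IsCMField.complexConj L) 2).quotFun (eisensteinSeriesU (fun g => f (borelHeight g) * φ g))) 2 μ), v = hv.toLp _}).topologicalClosure.starProjection (P y)⟫_ℂ = 0 :=
    Submodule.inner_right_of_mem_orthogonal hv (Submodule.sub_starProjection_mem_orthogonal (P y))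
  calc ⟪v, y⟫_ℂ = ⟪P v, y⟫_ℂ := by rw [hPfix v hv]
    _ = ⟪v, P y⟫_ℂ := hPsa v y
    _ = ⟪v, (Submodule.span ℂ {v : (quasiSplit (↥(maximalRealSubfield L)) L (IsCMField.complexConj L) 2).L2 μ |
        ∃ (f : ℝ → ℂ) (_ : Continuous f) (_ : HasCompactSupport f) (_ : tsupport f ⊆ Ioi 0)
          (φ : (quasiSplit (↥(maximalRealSubfield L)) L (IsCMField.complexConj L) 2).Adelic → ℂ) (_ : φ ∈ chiSectionSpace χ Kc ((1 : ↥Kc →* ℂ) : ↥Kc → ℂ)) (_ : Continuous φ)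
          (hv : MemLp ((quasiSplit (↥(maximalRealSubfield L)) L (IsCMField.complexConj L) 2).quotFun (eisensteinSeriesU (fun g => f (borelHeight g) * φ g))) 2 μ), v = hv.toLp _}).topologicalClosure.starProjection (P y) + (P y - (Submodule.span ℂ {v : (quasiSplit (↥(maximalRealSubfield L)) L (IsCMField.complexConj L) 2).L2 μ |
        ∃ (f : ℝ → ℂ) (_ : Continuous f) (_ : HasCompactSupport f) (_ : tsupport f ⊆ Ioi 0)
          (φ : (quasiSplit (↥(maximalRealSubfield L)) L (IsCMField.complexConj L) 2).Adelic → ℂ) (_ : φ ∈ chiSectionSpace χ Kc ((1 : ↥Kc →* ℂ) : ↥Kc → ℂ)) (_ : Continuous φ)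
          (hv : MemLp ((quasiSplit (↥(maximalRealSubfield L)) L (IsCMField.complexConj L) 2).quotFun (eisensteinSeriesU (fun g => f (borelHeight g) * φ g))) 2 μ), v = hv.toLp _}).topologicalClosure.starProjection (P y))⟫_ℂ := by rw [add_sub_cancel]
    _ = 0 := by rw [inner_add_right, h2, hproj0, inner_zero_right, zero_add]

/-! ## §2 The (N_blk) clause BY NAME for the off-dual blocks at `ω = 1`, for EVERY block-model coordinate map `U′` -/

include νinf μK in
/-- **(N_blk) FOR AN OFF-DUAL BLOCK AT `ω = 1`, OUTRIGHT** — the binder `hN ℓ b` of ★ p862113 `residual_le_topologicalClosure_iSup_charLines_of_letters` (bytes :90–92; H7's `hN Kf … ω … b`)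
at `(K′ ℓ, ω ℓ, ↑b) := (K_c, 1, χ)` and `Ln ℓ b := resHLine L μ U′ K_c 1 χ` for ANY block-model coordinate map `U′ : L² →ₗ[ℂ] A × Λ` (the line part of the block never exceeds the block,
★ `resHLine_le_resHBlock`, and §1 makes every irreducible orthogonal to the whole block; the residual and isotypic hypotheses are idle).  Same visible structural binders as §1.
[cite: MoeglinWaldspurger1995, IV.1.10, IV.3.12, V.3.13, VI.2] [cite: ReedSimonI1980, Thm. II.3] -/
theorem resH_isotypic_le_orthogonal_lines_offDual_one [MeasurableMul (finAdelic (↥(maximalRealSubfield L)) L (IsCMField.complexConj L) 2 ((StdForm.antidiagonal 2).over L))] [ENNReal.HolderTriple ∞ 2 2] (hχ1 : ∀ k, χ₁ k = 1)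
    (K' : Subgroup (finAdelic (↥(maximalRealSubfield L)) L (IsCMField.complexConj L) 2 ((StdForm.antidiagonal 2).over L))) (hK'o : IsOpen (K' : Set (finAdelic (↥(maximalRealSubfield L)) L (IsCMField.complexConj L) 2 ((StdForm.antidiagonal 2).over L))))
    (he0 : ∀ x, x ∉ K' → e x = 0) (he1 : ∫ x, e x ∂νf = 1) (heK : ∀ k ∈ K', ∀ x, e (k * x) = e x) (hestar : ∀ x, mulStar (⇑e) x = e x)
    (U₀ : Subgroup (GL (Fin 2) (FiniteAdeleRing (𝓞 L) L))) (hU₀o : IsOpen (U₀ : Set (GL (Fin 2) (FiniteAdeleRing (𝓞 L) L)))) (hU₀c : IsCompact (U₀ : Set (GL (Fin 2) (FiniteAdeleRing (𝓞 L) L))))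
    (hK'U₀ : ∀ b : finAdelic (↥(maximalRealSubfield L)) L (IsCMField.complexConj L) 2 ((StdForm.antidiagonal 2).over L), b ∈ K' ↔ (b : GL (Fin 2) (FiniteAdeleRing (𝓞 L) L)) ∈ U₀)
    {Kc : Subgroup (quasiSplit (↥(maximalRealSubfield L)) L (IsCMField.complexConj L) 2).Adelic} (hKcK : Kc ≤ ((standardMaximalCompactGL 2 L).comap (adelicVal (↥(maximalRealSubfield L)) L (IsCMField.complexConj L) 2 ((StdForm.antidiagonal 2).over L)) : Subgroup (quasiSplit (↥(maximalRealSubfield L)) L (IsCMField.complexConj L) 2).Adelic))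
    (hKinfKc : ∀ k : UnitaryGroup.arch (↥(maximalRealSubfield L)) L (IsCMField.complexConj L) 2 ((StdForm.antidiagonal 2).over L), (adelicVal (↥(maximalRealSubfield L)) L (IsCMField.complexConj L) 2 ((StdForm.antidiagonal 2).over L)) ((archToAdelic (↥(maximalRealSubfield L)) L (IsCMField.complexConj L) 2 ((StdForm.antidiagonal 2).over L)) k) ∈ standardMaximalCompactGL 2 L → (archToAdelic (↥(maximalRealSubfield L)) L (IsCMField.complexConj L) 2 ((StdForm.antidiagonal 2).over L)) k ∈ Kc)
    (hU₀Kc : ∀ b : finAdelic (↥(maximalRealSubfield L)) L (IsCMField.complexConj L) 2 ((StdForm.antidiagonal 2).over L), (b : GL (Fin 2) (FiniteAdeleRing (𝓞 L) L)) ∈ U₀ → (finAdelicToAdelic (↥(maximalRealSubfield L)) L (IsCMField.complexConj L) 2 ((StdForm.antidiagonal 2).over L)) b ∈ Kc)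
    (μKU : Measure ↥((standardMaximalCompactGL 2 L).comap (adelicVal (↥(maximalRealSubfield L)) L (IsCMField.complexConj L) 2 ((StdForm.antidiagonal 2).over L)) : Subgroup (quasiSplit (↥(maximalRealSubfield L)) L (IsCMField.complexConj L) 2).Adelic)) [μKU.IsHaarMeasure]
    {χ : HeckeCharacter L} (hχu : χ.IsUnitary) (hoff : ¬ (χ * (reflectChar (IsCMField.complexConj L) χ)⁻¹).IsNormTwist)
    (hVc : ∀ φ ∈ chiSectionSpace χ Kc 1, Continuous φ)
    (𝔓 : (quasiSplit (↥(maximalRealSubfield L)) L (IsCMField.complexConj L) 2).ParabolicUnipotentData)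
    {A Λ : Type*} [AddCommGroup A] [Module ℂ A] [AddCommGroup Λ] [Module ℂ Λ] (U' : (quasiSplit (↥(maximalRealSubfield L)) L (IsCMField.complexConj L) 2).L2 μ →ₗ[ℂ] A × Λ) :
    ∀ W' : ClosedSubrep ((quasiSplit (↥(maximalRealSubfield L)) L (IsCMField.complexConj L) 2).rightRegular μ), W'.toContRep.IsTopIrreducible → W' ≤ residualSubspace (quasiSplit (↥(maximalRealSubfield L)) L (IsCMField.complexConj L) 2) μ 𝔓 →
      W'.toSubmodule ⊓ (⨅ k : ↥Kc, Module.End.eigenspace ((((quasiSplit (↥(maximalRealSubfield L)) L (IsCMField.complexConj L) 2).rightRegular μ) (Kc.subtype k) : (quasiSplit (↥(maximalRealSubfield L)) L (IsCMField.complexConj L) 2).L2 μ →L[ℂ] (quasiSplit (↥(maximalRealSubfield L)) L (IsCMField.complexConj L) 2).L2 μ) : (quasiSplit (↥(maximalRealSubfield L)) L (IsCMField.complexConj L) 2).L2 μ →ₗ[ℂ] (quasiSplit (↥(maximalRealSubfield L)) L (IsCMField.complexConj L) 2).L2 μ) ((1 : ↥Kc →* ℂ) k)) ≤ (resHLine L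 μ U' Kc 1 χ)ᗮ := by
  intro W' hW' _
  exact inf_le_left.trans ((subrep_le_orthogonal_resHBlock_offDual_one L μ νinf νf μK χ₁ e hχ1 K' hK'o he0 he1 heK hestar U₀ hU₀o hU₀c hK'U₀ hKcK hKinfKc hU₀Kc μKU hχu hoff hVc W' hW').trans
    (Submodule.orthogonal_le (resHLine_le_resHBlock L μ U' Kc 1 χ)))

/-! ## §3 H7's level family `K_c := Kad(K′_f) = ⟨ι_∞(K_∞) ∪ ι_f(K′_f)⟩`: the three level inclusions discharged -/

omit [MeasurableSpace (quasiSplit (↥(maximalRealSubfield L)) L (IsCMField.complexConj L) 2).Adelic] [BorelSpace (quasiSplit (↥(maximalRealSubfield L)) L (IsCMField.complexConj L) 2).Adelic] [(quasiSplit (↥(maximalRealSubfield L)) L (IsCMField.complexConj L) 2).IsAutomorphicMeasure μ] [MeasurableSpace (UnitaryGroup.arch (↥(maximalRealSubfield L)) L (IsCMField.complexConj L) 2 ((StdForm.antidiagonal 2).over L))] [BorelSpace (UnitaryGroup.arch (↥(maximalRealSubfield L)) L (IsCMField.complexConj L) 2 ((StdForm.antidiagonal 2).over L))] [MeasurableSpace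 (finAdelic (↥(maximalRealSubfield L)) L (IsCMField.complexConj L) 2 ((StdForm.antidiagonal 2).over L))] [BorelSpace (finAdelic (↥(maximalRealSubfield L)) L (IsCMField.complexConj L) 2 ((StdForm.antidiagonal 2).over L))]
  [MeasurableSpace ↥(UnitaryGroup.arch (↥(maximalRealSubfield L)) L (IsCMField.complexConj L) 2 ((StdForm.antidiagonal 2).over L) ⊓ unitaryGroupOfForm (conjMixed (↥(maximalRealSubfield L)) L (IsCMField.complexConj L)) 1)] [BorelSpace ↥(UnitaryGroup.arch (↥(maximalRealSubfield L)) L (IsCMField.complexConj L) 2 ((StdForm.antidiagonal 2).over L) ⊓ unitaryGroupOfForm (conjMixed (↥(maximalRealSubfield L)) L (IsCMField.complexConj L)) 1)] in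
/-- **THE LEVEL `Kad(K′_f)` MEETS ★ FILE 1c's THREE INCLUSIONS** for `K′_f ⊆ GL₂(𝒪̂_L)` cut out by `U₀`: `Kad ≤ K` (★ `closure_arch_fin_le_maximalLevel`), `ι_∞(k) ∈ Kad` whenever
`ι_∞(k) ∈ K` (then `k ∈ U(1 ⊗ 1)`, ★ `mem_unitaryOne_of_coe_mem_Kinf`, so `ι_∞(k)` is a generator), and `ι_f(b) ∈ Kad` for `b ∈ U₀` (a generator, `hK′U₀`). [cite: BorelJacquet1979, §4.1] -/
theorem kad_level_inclusions (K'f : Subgroup ↥(finAdelic (↥(maximalRealSubfield L)) L (IsCMField.complexConj L) 2 ((StdForm.antidiagonal 2).over L)))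
    (hKf : ∀ u : ↥(finAdelic (↥(maximalRealSubfield L)) L (IsCMField.complexConj L) 2 ((StdForm.antidiagonal 2).over L)), u ∈ K'f → ((u : ↥(finAdelic (↥(maximalRealSubfield L)) L (IsCMField.complexConj L) 2 ((StdForm.antidiagonal 2).over L))) : GL (Fin 2) (FiniteAdeleRing (𝓞 L) L)) ∈ glFiniteIntegralLevel 2 L)
    (U₀ : Subgroup (GL (Fin 2) (FiniteAdeleRing (𝓞 L) L))) (hK'U₀ : ∀ b : finAdelic (↥(maximalRealSubfield L)) L (IsCMField.complexConj L) 2 ((StdForm.antidiagonal 2).over L), b ∈ K'f ↔ (b : GL (Fin 2) (FiniteAdeleRing (𝓞 L) L)) ∈ U₀) :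
    (Subgroup.closure ((Set.range (fun k : ↥(UnitaryGroup.arch (↥(maximalRealSubfield L)) L (IsCMField.complexConj L) 2 ((StdForm.antidiagonal 2).over L) ⊓ unitaryGroupOfForm (conjMixed (↥(maximalRealSubfield L)) L (IsCMField.complexConj L)) 1) => (archToAdelic (↥(maximalRealSubfield L)) L (IsCMField.complexConj L) 2 ((StdForm.antidiagonal 2).over L)) ((Subgroup.inclusion (inf_le_left : UnitaryGroup.arch (↥(maximalRealSubfield L)) L (IsCMField.complexConj L) 2 ((StdForm.antidiagonal 2).over L) ⊓ unitaryGroupOfForm (conjMixed (↥(maximalRealSubfield L)) L (IsCMField.complexConj L)) 1 ≤ UnitaryGroup.arch (↥(maximalRealSubfield L)) L (IsCMField.complexConj L) 2 ((StdForm.antidiagonal 2).over L))) k)) ∪ (finAdelicToAdelic (↥(maximalRealSubfield L)) L (IsCMField.complexConj L) 2 ((StdForm.antidiagonal 2).over L)) '' ((K'f : Subgroup ↥(finAdelic (↥(maximalRealSubfield L)) L (IsCMField.complexConj L) 2 ((StdForm.antidiagonal 2).over L))) : Set ↥(finAdelic (↥(maximalRealSubfield L)) L (IsCMField.complexConj L)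 2 ((StdForm.antidiagonal 2).over L)))) : Set (quasiSplit (↥(maximalRealSubfield L)) L (IsCMField.complexConj L) 2).Adelic)) ≤ ((standardMaximalCompactGL 2 L).comap (adelicVal (↥(maximalRealSubfield L)) L (IsCMField.complexConj L) 2 ((StdForm.antidiagonal 2).over L)) : Subgroup (quasiSplit (↥(maximalRealSubfield L)) L (IsCMField.complexConj L) 2).Adelic) ∧
    (∀ k : UnitaryGroup.arch (↥(maximalRealSubfield L)) L (IsCMField.complexConj L) 2 ((StdForm.antidiagonal 2).over L), (adelicVal (↥(maximalRealSubfield L)) L (IsCMField.complexConj L) 2 ((StdForm.antidiagonal 2).over L)) ((archToAdelic (↥(maximalRealSubfield L)) L (IsCMField.complexConj L) 2 ((StdForm.antidiagonal 2).over L)) k) ∈ standardMaximalCompactGL 2 L → (archToAdelic (↥(maximalRealSubfield L)) L (IsCMField.complexConj L) 2 ((StdForm.antidiagonal 2).over L)) k ∈ (Subgroup.closure ((Set.range (fun k : ↥(UnitaryGroup.arch (↥(maximalRealSubfield L)) L (IsCMField.complexConj L) 2 ((StdForm.antidiagonal 2).over L) ⊓ unitaryGroupOfForm (conjMixed (↥(maximalRealSubfield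 L)) L (IsCMField.complexConj L)) 1) => (archToAdelic (↥(maximalRealSubfield L)) L (IsCMField.complexConj L) 2 ((StdForm.antidiagonal 2).over L)) ((Subgroup.inclusion (inf_le_left : UnitaryGroup.arch (↥(maximalRealSubfield L)) L (IsCMField.complexConj L) 2 ((StdForm.antidiagonal 2).over L) ⊓ unitaryGroupOfForm (conjMixed (↥(maximalRealSubfield L)) L (IsCMField.complexConj L)) 1 ≤ UnitaryGroup.arch (↥(maximalRealSubfield L)) L (IsCMField.complexConj L) 2 ((StdForm.antidiagonal 2).over L))) k)) ∪ (finAdelicToAdelic (↥(maximalRealSubfield L)) L (IsCMField.complexConj L) 2 ((StdForm.antidiagonal 2).over L)) '' ((K'f : Subgroup ↥(finAdelic (↥(maximalRealSubfield L)) L (IsCMField.complexConj L) 2 ((StdForm.antidiagonal 2).over L))) : Set ↥(finAdelic (↥(maximalRealSubfield L)) L (IsCMField.complexConj L) 2 ((StdForm.antidiagonal 2).over L)))) : Set (quasiSplit (↥(maximalRealSubfield L)) L (IsCMField.complexConj L) 2).Adelic))) ∧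
    (∀ b : finAdelic (↥(maximalRealSubfield L)) L (IsCMField.complexConj L) 2 ((StdForm.antidiagonal 2).over L), (b : GL (Fin 2) (FiniteAdeleRing (𝓞 L) L)) ∈ U₀ → (finAdelicToAdelic (↥(maximalRealSubfield L)) L (IsCMField.complexConj L) 2 ((StdForm.antidiagonal 2).over L)) b ∈ (Subgroup.closure ((Set.range (fun k : ↥(UnitaryGroup.arch (↥(maximalRealSubfield L)) L (IsCMField.complexConj L) 2 ((StdForm.antidiagonal 2).over L) ⊓ unitaryGroupOfForm (conjMixed (↥(maximalRealSubfield L)) L (IsCMField.complexConj L)) 1) => (archToAdelic (↥(maximalRealSubfield L)) L (IsCMField.complexConj L) 2 ((StdForm.antidiagonal 2).over L)) ((Subgroup.inclusion (inf_le_left : UnitaryGroup.arch (↥(maximalRealSubfield L)) L (IsCMField.complexConj L) 2 ((StdForm.antidiagonal 2).over L) ⊓ unitaryGroupOfForm (conjMixed (↥(maximalRealSubfield L)) L (IsCMField.complexConj L)) 1 ≤ UnitaryGroup.arch (↥(maximalRealSubfield L)) L (IsCMField.complexConj L) 2 ((StdForm.antidiagonal 2).over L))) k)) ∪ (finAdelicToAdelic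 (↥(maximalRealSubfield L)) L (IsCMField.complexConj L) 2 ((StdForm.antidiagonal 2).over L)) '' ((K'f : Subgroup ↥(finAdelic (↥(maximalRealSubfield L)) L (IsCMField.complexConj L) 2 ((StdForm.antidiagonal 2).over L))) : Set ↥(finAdelic (↥(maximalRealSubfield L)) L (IsCMField.complexConj L) 2 ((StdForm.antidiagonal 2).over L)))) : Set (quasiSplit (↥(maximalRealSubfield L)) L (IsCMField.complexConj L) 2).Adelic))) := by
  refine ⟨closure_arch_fin_le_maximalLevel (L := L) (N := 2) (H := ((StdForm.antidiagonal 2).over L)) K'f hKf, fun k hk => ?_, fun b hb => Subgroup.subset_closure (Or.inr ⟨b, (hK'U₀ b).2 hb, rfl⟩)⟩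
  -- `ι_∞(k) ∈ K` forces `k ∈ U(1 ⊗ 1)`, so `ι_∞(k)` is one of the generators
  have hinf := ((mem_standardMaximalCompactGL_iff_toMixed_sndHom _).1 hk).1
  rw [adelicVal_archToAdelic, GLn.toMixed_ofInfinite] at hinf
  have hmem := mem_unitaryOne_of_coe_mem_Kinf k hinf
  exact Subgroup.subset_closure (Or.inl ⟨⟨(k : GL (Fin 2) (mixedSpace L)), k.2, hmem⟩, rfl⟩)

include νinf μK in
/-- **THE OFF-DUAL BLOCK OF LEVEL `Kad(K′_f)` CARRIES NO DISCRETE MASS** (§1 at H7's level family): for `K′_f ⊆ GL₂(𝒪̂_L)` open, cut out by an open compact `U₀ ≤ GL₂(𝔸_{L,f})`, with its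
idempotent `e`, and continuous sections of `V(χ, Kad(K′_f), 1)`: every topologically irreducible closed `W′ ≤ L²` is orthogonal to `resHBlock L μ (Kad K′_f) 1 χ` for every unitary off-dual `χ`.
[cite: MoeglinWaldspurger1995, IV.1.10, IV.3.12, VI.2] [cite: BorelJacquet1979, §4.1] -/
theorem subrep_le_orthogonal_resHBlock_offDual_kad [MeasurableMul (finAdelic (↥(maximalRealSubfield L)) L (IsCMField.complexConj L) 2 ((StdForm.antidiagonal 2).over L))] [ENNReal.HolderTriple ∞ 2 2] (hχ1 : ∀ k, χ₁ k = 1)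
    (K'f : Subgroup ↥(finAdelic (↥(maximalRealSubfield L)) L (IsCMField.complexConj L) 2 ((StdForm.antidiagonal 2).over L))) (hK'o : IsOpen (K'f : Set (finAdelic (↥(maximalRealSubfield L)) L (IsCMField.complexConj L) 2 ((StdForm.antidiagonal 2).over L))))
    (hKf : ∀ u : ↥(finAdelic (↥(maximalRealSubfield L)) L (IsCMField.complexConj L) 2 ((StdForm.antidiagonal 2).over L)), u ∈ K'f → ((u : ↥(finAdelic (↥(maximalRealSubfield L)) L (IsCMField.complexConj L) 2 ((StdForm.antidiagonal 2).over L))) : GL (Fin 2) (FiniteAdeleRing (𝓞 L) L)) ∈ glFiniteIntegralLevel 2 L)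
    (he0 : ∀ x, x ∉ K'f → e x = 0) (he1 : ∫ x, e x ∂νf = 1) (heK : ∀ k ∈ K'f, ∀ x, e (k * x) = e x) (hestar : ∀ x, mulStar (⇑e) x = e x)
    (U₀ : Subgroup (GL (Fin 2) (FiniteAdeleRing (𝓞 L) L))) (hU₀o : IsOpen (U₀ : Set (GL (Fin 2) (FiniteAdeleRing (𝓞 L) L)))) (hU₀c : IsCompact (U₀ : Set (GL (Fin 2) (FiniteAdeleRing (𝓞 L) L))))
    (hK'U₀ : ∀ b : finAdelic (↥(maximalRealSubfield L)) L (IsCMField.complexConj L) 2 ((StdForm.antidiagonal 2).over L), b ∈ K'f ↔ (b : GL (Fin 2) (FiniteAdeleRing (𝓞 L) L)) ∈ U₀)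
    (μKU : Measure ↥((standardMaximalCompactGL 2 L).comap (adelicVal (↥(maximalRealSubfield L)) L (IsCMField.complexConj L) 2 ((StdForm.antidiagonal 2).over L)) : Subgroup (quasiSplit (↥(maximalRealSubfield L)) L (IsCMField.complexConj L) 2).Adelic)) [μKU.IsHaarMeasure]
    {χ : HeckeCharacter L} (hχu : χ.IsUnitary) (hoff : ¬ (χ * (reflectChar (IsCMField.complexConj L) χ)⁻¹).IsNormTwist)
    (hVc : ∀ φ ∈ chiSectionSpace χ (Subgroup.closure ((Set.range (fun k : ↥(UnitaryGroup.arch (↥(maximalRealSubfield L)) L (IsCMField.complexConj L) 2 ((StdForm.antidiagonal 2).over L) ⊓ unitaryGroupOfForm (conjMixed (↥(maximalRealSubfield L)) L (IsCMField.complexConj L)) 1) => (archToAdelic (↥(maximalRealSubfield L)) L (IsCMField.complexConj L) 2 ((StdForm.antidiagonal 2).over L)) ((Subgroup.inclusion (inf_le_left : UnitaryGroup.arch (↥(maximalRealSubfield L)) L (IsCMField.complexConj L) 2 ((StdForm.antidiagonal 2).over L) ⊓ unitaryGroupOfForm (conjMixed (↥(maximalRealSubfield L)) L (IsCMField.complexConj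 L)) 1 ≤ UnitaryGroup.arch (↥(maximalRealSubfield L)) L (IsCMField.complexConj L) 2 ((StdForm.antidiagonal 2).over L))) k)) ∪ (finAdelicToAdelic (↥(maximalRealSubfield L)) L (IsCMField.complexConj L) 2 ((StdForm.antidiagonal 2).over L)) '' ((K'f : Subgroup ↥(finAdelic (↥(maximalRealSubfield L)) L (IsCMField.complexConj L) 2 ((StdForm.antidiagonal 2).over L))) : Set ↥(finAdelic (↥(maximalRealSubfield L)) L (IsCMField.complexConj L) 2 ((StdForm.antidiagonal 2).over L)))) : Set (quasiSplit (↥(maximalRealSubfield L)) L (IsCMField.complexConj L) 2).Adelic)) 1, Continuous φ) :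
    ∀ W' : ClosedSubrep ((quasiSplit (↥(maximalRealSubfield L)) L (IsCMField.complexConj L) 2).rightRegular μ), W'.toContRep.IsTopIrreducible → W'.toSubmodule ≤ (resHBlock L μ (Subgroup.closure ((Set.range (fun k : ↥(UnitaryGroup.arch (↥(maximalRealSubfield L)) L (IsCMField.complexConj L) 2 ((StdForm.antidiagonal 2).over L) ⊓ unitaryGroupOfForm (conjMixed (↥(maximalRealSubfield L)) L (IsCMField.complexConj L)) 1) => (archToAdelic (↥(maximalRealSubfield L)) L (IsCMField.complexConj L) 2 ((StdForm.antidiagonal 2).over L)) ((Subgroup.inclusion (inf_le_left : UnitaryGroup.arch (↥(maximalRealSubfield L)) L (IsCMField.complexConj L) 2 ((StdForm.antidiagonal 2).over L) ⊓ unitaryGroupOfForm (conjMixed (↥(maximalRealSubfield L)) L (IsCMField.complexConj L)) 1 ≤ UnitaryGroup.arch (↥(maximalRealSubfield L)) L (IsCMField.complexConj L) 2 ((StdForm.antidiagonal 2).over L))) k)) ∪ (finAdelicToAdelic (↥(maximalRealSubfield L)) L (IsCMField.complexConj L) 2 ((StdForm.antidiagonal 2).over L)) '' ((K'f : Subgroup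 ↥(finAdelic (↥(maximalRealSubfield L)) L (IsCMField.complexConj L) 2 ((StdForm.antidiagonal 2).over L))) : Set ↥(finAdelic (↥(maximalRealSubfield L)) L (IsCMField.complexConj L) 2 ((StdForm.antidiagonal 2).over L)))) : Set (quasiSplit (↥(maximalRealSubfield L)) L (IsCMField.complexConj L) 2).Adelic)) 1 χ)ᗮ := by
  obtain ⟨hKcK, hKinfKc, hU₀Kc⟩ := kad_level_inclusions L K'f hKf U₀ hK'U₀
  exact subrep_le_orthogonal_resHBlock_offDual_one L μ νinf νf μK χ₁ e hχ1 K'f hK'o he0 he1 heK hestar U₀ hU₀o hU₀c hK'U₀ hKcK hKinfKc hU₀Kc μKU hχu hoff hVc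

include νinf μK in
/-- **(N_blk) AT H7's LEVEL FAMILY `Kad(K′_f)`, `ω = 1`, OFF-DUAL `χ`** — the `hN` bytes for every block-model map `U′` (§2 ∘ §3). [cite: MoeglinWaldspurger1995, IV.1.10, V.3.13, VI.2] -/
theorem resH_isotypic_le_orthogonal_lines_offDual_kad [MeasurableMul (finAdelic (↥(maximalRealSubfield L)) L (IsCMField.complexConj L) 2 ((StdForm.antidiagonal 2).over L))] [ENNReal.HolderTriple ∞ 2 2] (hχ1 : ∀ k, χ₁ k = 1)
    (K'f : Subgroup ↥(finAdelic (↥(maximalRealSubfield L)) L (IsCMField.complexConj L) 2 ((StdForm.antidiagonal 2).over L))) (hK'o : IsOpen (K'f : Set (finAdelic (↥(maximalRealSubfield L)) L (IsCMField.complexConj L) 2 ((StdForm.antidiagonal 2).over L))))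
    (hKf : ∀ u : ↥(finAdelic (↥(maximalRealSubfield L)) L (IsCMField.complexConj L) 2 ((StdForm.antidiagonal 2).over L)), u ∈ K'f → ((u : ↥(finAdelic (↥(maximalRealSubfield L)) L (IsCMField.complexConj L) 2 ((StdForm.antidiagonal 2).over L))) : GL (Fin 2) (FiniteAdeleRing (𝓞 L) L)) ∈ glFiniteIntegralLevel 2 L)
    (he0 : ∀ x, x ∉ K'f → e x = 0) (he1 : ∫ x, e x ∂νf = 1) (heK : ∀ k ∈ K'f, ∀ x, e (k * x) = e x) (hestar : ∀ x, mulStar (⇑e) x = e x)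
    (U₀ : Subgroup (GL (Fin 2) (FiniteAdeleRing (𝓞 L) L))) (hU₀o : IsOpen (U₀ : Set (GL (Fin 2) (FiniteAdeleRing (𝓞 L) L)))) (hU₀c : IsCompact (U₀ : Set (GL (Fin 2) (FiniteAdeleRing (𝓞 L) L))))
    (hK'U₀ : ∀ b : finAdelic (↥(maximalRealSubfield L)) L (IsCMField.complexConj L) 2 ((StdForm.antidiagonal 2).over L), b ∈ K'f ↔ (b : GL (Fin 2) (FiniteAdeleRing (𝓞 L) L)) ∈ U₀)
    (μKU : Measure ↥((standardMaximalCompactGL 2 L).comap (adelicVal (↥(maximalRealSubfield L)) L (IsCMField.complexConj L) 2 ((StdForm.antidiagonal 2).over L)) : Subgroup (quasiSplit (↥(maximalRealSubfield L)) L (IsCMField.complexConj L) 2).Adelic)) [μKU.IsHaarMeasure]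
    {χ : HeckeCharacter L} (hχu : χ.IsUnitary) (hoff : ¬ (χ * (reflectChar (IsCMField.complexConj L) χ)⁻¹).IsNormTwist)
    (hVc : ∀ φ ∈ chiSectionSpace χ (Subgroup.closure ((Set.range (fun k : ↥(UnitaryGroup.arch (↥(maximalRealSubfield L)) L (IsCMField.complexConj L) 2 ((StdForm.antidiagonal 2).over L) ⊓ unitaryGroupOfForm (conjMixed (↥(maximalRealSubfield L)) L (IsCMField.complexConj L)) 1) => (archToAdelic (↥(maximalRealSubfield L)) L (IsCMField.complexConj L) 2 ((StdForm.antidiagonal 2).over L)) ((Subgroup.inclusion (inf_le_left : UnitaryGroup.arch (↥(maximalRealSubfield L)) L (IsCMField.complexConj L) 2 ((StdForm.antidiagonal 2).over L) ⊓ unitaryGroupOfForm (conjMixed (↥(maximalRealSubfield L)) L (IsCMField.complexConj L)) 1 ≤ UnitaryGroup.arch (↥(maximalRealSubfield L)) L (IsCMField.complexConj L) 2 ((StdForm.antidiagonal 2).over L))) k)) ∪ (finAdelicToAdelic (↥(maximalRealSubfield L)) L (IsCMField.complexConj L) 2 ((StdForm.antidiagonal 2).over L)) '' ((K'f : Subgroup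 ↥(finAdelic (↥(maximalRealSubfield L)) L (IsCMField.complexConj L) 2 ((StdForm.antidiagonal 2).over L))) : Set ↥(finAdelic (↥(maximalRealSubfield L)) L (IsCMField.complexConj L) 2 ((StdForm.antidiagonal 2).over L)))) : Set (quasiSplit (↥(maximalRealSubfield L)) L (IsCMField.complexConj L) 2).Adelic)) 1, Continuous φ)
    (𝔓 : (quasiSplit (↥(maximalRealSubfield L)) L (IsCMField.complexConj L) 2).ParabolicUnipotentData)
    {A Λ : Type*} [AddCommGroup A] [Module ℂ A] [AddCommGroup Λ] [Module ℂ Λ] (U' : (quasiSplit (↥(maximalRealSubfield L)) L (IsCMField.complexConj L) 2).L2 μ →ₗ[ℂ] A × Λ) :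
    ∀ W' : ClosedSubrep ((quasiSplit (↥(maximalRealSubfield L)) L (IsCMField.complexConj L) 2).rightRegular μ), W'.toContRep.IsTopIrreducible → W' ≤ residualSubspace (quasiSplit (↥(maximalRealSubfield L)) L (IsCMField.complexConj L) 2) μ 𝔓 →
      W'.toSubmodule ⊓ (⨅ k : ↥(Subgroup.closure ((Set.range (fun k : ↥(UnitaryGroup.arch (↥(maximalRealSubfield L)) L (IsCMField.complexConj L) 2 ((StdForm.antidiagonal 2).over L) ⊓ unitaryGroupOfForm (conjMixed (↥(maximalRealSubfield L)) L (IsCMField.complexConj L)) 1) => (archToAdelic (↥(maximalRealSubfield L)) L (IsCMField.complexConj L) 2 ((StdForm.antidiagonal 2).over L)) ((Subgroup.inclusion (inf_le_left : UnitaryGroup.arch (↥(maximalRealSubfield L)) L (IsCMField.complexConj L) 2 ((StdForm.antidiagonal 2).over L) ⊓ unitaryGroupOfForm (conjMixed (↥(maximalRealSubfield L)) L (IsCMField.complexConj L)) 1 ≤ UnitaryGroup.arch (↥(maximalRealSubfield L)) L (IsCMField.complexConj L) 2 ((StdForm.antidiagonal 2).over L))) k)) ∪ (finAdelicToAdelic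 (↥(maximalRealSubfield L)) L (IsCMField.complexConj L) 2 ((StdForm.antidiagonal 2).over L)) '' ((K'f : Subgroup ↥(finAdelic (↥(maximalRealSubfield L)) L (IsCMField.complexConj L) 2 ((StdForm.antidiagonal 2).over L))) : Set ↥(finAdelic (↥(maximalRealSubfield L)) L (IsCMField.complexConj L) 2 ((StdForm.antidiagonal 2).over L)))) : Set (quasiSplit (↥(maximalRealSubfield L)) L (IsCMField.complexConj L) 2).Adelic)), Module.End.eigenspace ((((quasiSplit (↥(maximalRealSubfield L)) L (IsCMField.complexConj L) 2).rightRegular μ) (((Subgroup.closure ((Set.range (fun k : ↥(UnitaryGroup.arch (↥(maximalRealSubfield L)) L (IsCMField.complexConj L) 2 ((StdForm.antidiagonal 2).over L) ⊓ unitaryGroupOfForm (conjMixed (↥(maximalRealSubfield L)) L (IsCMField.complexConj L)) 1) => (archToAdelic (↥(maximalRealSubfield L)) L (IsCMField.complexConj L) 2 ((StdForm.antidiagonal 2).over L)) ((Subgroup.inclusion (inf_le_left : UnitaryGroup.arch (↥(maximalRealSubfield L)) L (IsCMField.complexConj L) 2 ((StdForm.antidiagonal 2).over L) ⊓ unitaryGroupOfForm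 (conjMixed (↥(maximalRealSubfield L)) L (IsCMField.complexConj L)) 1 ≤ UnitaryGroup.arch (↥(maximalRealSubfield L)) L (IsCMField.complexConj L) 2 ((StdForm.antidiagonal 2).over L))) k)) ∪ (finAdelicToAdelic (↥(maximalRealSubfield L)) L (IsCMField.complexConj L) 2 ((StdForm.antidiagonal 2).over L)) '' ((K'f : Subgroup ↥(finAdelic (↥(maximalRealSubfield L)) L (IsCMField.complexConj L) 2 ((StdForm.antidiagonal 2).over L))) : Set ↥(finAdelic (↥(maximalRealSubfield L)) L (IsCMField.complexConj L) 2 ((StdForm.antidiagonal 2).over L)))) : Set (quasiSplit (↥(maximalRealSubfield L)) L (IsCMField.complexConj L) 2).Adelic))).subtype k) : (quasiSplit (↥(maximalRealSubfield L)) L (IsCMField.complexConj L) 2).L2 μ →L[ℂ] (quasiSplit (↥(maximalRealSubfield L)) L (IsCMField.complexConj L) 2).L2 μ) : (quasiSplit (↥(maximalRealSubfield L)) L (IsCMField.complexConj L) 2).L2 μ →ₗ[ℂ] (quasiSplit (↥(maximalRealSubfield L)) L (IsCMField.complexConj L) 2).L2 μ) ((1 : ↥(Subgroup.closure ((Set.range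 (fun k : ↥(UnitaryGroup.arch (↥(maximalRealSubfield L)) L (IsCMField.complexConj L) 2 ((StdForm.antidiagonal 2).over L) ⊓ unitaryGroupOfForm (conjMixed (↥(maximalRealSubfield L)) L (IsCMField.complexConj L)) 1) => (archToAdelic (↥(maximalRealSubfield L)) L (IsCMField.complexConj L) 2 ((StdForm.antidiagonal 2).over L)) ((Subgroup.inclusion (inf_le_left : UnitaryGroup.arch (↥(maximalRealSubfield L)) L (IsCMField.complexConj L) 2 ((StdForm.antidiagonal 2).over L) ⊓ unitaryGroupOfForm (conjMixed (↥(maximalRealSubfield L)) L (IsCMField.complexConj L)) 1 ≤ UnitaryGroup.arch (↥(maximalRealSubfield L)) L (IsCMField.complexConj L) 2 ((StdForm.antidiagonal 2).over L))) k)) ∪ (finAdelicToAdelic (↥(maximalRealSubfield L)) L (IsCMField.complexConj L) 2 ((StdForm.antidiagonal 2).over L)) '' ((K'f : Subgroup ↥(finAdelic (↥(maximalRealSubfield L)) L (IsCMField.complexConj L) 2 ((StdForm.antidiagonal 2).over L))) : Set ↥(finAdelic (↥(maximalRealSubfield L)) L (IsCMField.complexConj L) 2 ((StdForm.antidiagonal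 2).over L)))) : Set (quasiSplit (↥(maximalRealSubfield L)) L (IsCMField.complexConj L) 2).Adelic)) →* ℂ) k)) ≤
        (resHLine L μ U' (Subgroup.closure ((Set.range (fun k : ↥(UnitaryGroup.arch (↥(maximalRealSubfield L)) L (IsCMField.complexConj L) 2 ((StdForm.antidiagonal 2).over L) ⊓ unitaryGroupOfForm (conjMixed (↥(maximalRealSubfield L)) L (IsCMField.complexConj L)) 1) => (archToAdelic (↥(maximalRealSubfield L)) L (IsCMField.complexConj L) 2 ((StdForm.antidiagonal 2).over L)) ((Subgroup.inclusion (inf_le_left : UnitaryGroup.arch (↥(maximalRealSubfield L)) L (IsCMField.complexConj L) 2 ((StdForm.antidiagonal 2).over L) ⊓ unitaryGroupOfForm (conjMixed (↥(maximalRealSubfield L)) L (IsCMField.complexConj L)) 1 ≤ UnitaryGroup.arch (↥(maximalRealSubfield L)) L (IsCMField.complexConj L) 2 ((StdForm.antidiagonal 2).over L))) k)) ∪ (finAdelicToAdelic (↥(maximalRealSubfield L)) L (IsCMField.complexConj L) 2 ((StdForm.antidiagonal 2).over L)) '' ((K'f : Subgroup ↥(finAdelic (↥(maximalRealSubfield L))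 L (IsCMField.complexConj L) 2 ((StdForm.antidiagonal 2).over L))) : Set ↥(finAdelic (↥(maximalRealSubfield L)) L (IsCMField.complexConj L) 2 ((StdForm.antidiagonal 2).over L)))) : Set (quasiSplit (↥(maximalRealSubfield L)) L (IsCMField.complexConj L) 2).Adelic)) 1 χ)ᗮ := by
  obtain ⟨hKcK, hKinfKc, hU₀Kc⟩ := kad_level_inclusions L K'f hKf U₀ hK'U₀
  exact resH_isotypic_le_orthogonal_lines_offDual_one L μ νinf νf μK χ₁ e hχ1 K'f hK'o he0 he1 heK hestar U₀ hU₀o hU₀c hK'U₀ hKcK hKinfKc hU₀Kc μKU hχu hoff hVc 𝔓 U'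

/-! ## §4 M1: the maximal level `K = K_∞·GL₂(𝒪̂_L)`, `K′_f = GL₂(𝒪̂_L) ∩ G(𝔸_f)` — every structural binder discharged -/

include νinf μK in
/-- **THE OFF-DUAL BLOCK OF MAXIMAL LEVEL CARRIES NO DISCRETE MASS, LETTER-LIGHT** (M1: `K_c := K`, `U₀ := GL₂(𝒪̂_L)`, `K′_f :=` its trace; ★ `m1_level_witness` for the seven structural
clauses, ★ `hVc_maximalLevel_one` for the continuity of the sections, the Haar measure of the compact `K_U` for the model): visible ONLY the measures `ν_∞, ν_f, μ_K`, the trivial `K_∞`-type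
`χ₁ ≡ 1` and the maximal-level idempotent `e` (`e* = e`).  For every unitary off-dual `χ` and every topologically irreducible closed `W′ ≤ L²`: `W′ ⟂ resHBlock L μ K 1 χ`.
[cite: MoeglinWaldspurger1995, IV.1.10, IV.3.12, VI.2] [cite: BorelJacquet1979, §4.1] -/
theorem subrep_le_orthogonal_resHBlock_offDual_maximalLevel [MeasurableMul (finAdelic (↥(maximalRealSubfield L)) L (IsCMField.complexConj L) 2 ((StdForm.antidiagonal 2).over L))] [ENNReal.HolderTriple ∞ 2 2] (hχ1 : ∀ k, χ₁ k = 1)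
    (he0 : ∀ x, x ∉ ((glFiniteIntegralLevel 2 L).comap (finAdelic (↥(maximalRealSubfield L)) L (IsCMField.complexConj L) 2 ((StdForm.antidiagonal 2).over L)).subtype : Subgroup (finAdelic (↥(maximalRealSubfield L)) L (IsCMField.complexConj L) 2 ((StdForm.antidiagonal 2).over L))) → e x = 0) (he1 : ∫ x, e x ∂νf = 1)
    (heK : ∀ k ∈ ((glFiniteIntegralLevel 2 L).comap (finAdelic (↥(maximalRealSubfield L)) L (IsCMField.complexConj L) 2 ((StdForm.antidiagonal 2).over L)).subtype : Subgroup (finAdelic (↥(maximalRealSubfield L)) L (IsCMField.complexConj L) 2 ((StdForm.antidiagonal 2).over L))), ∀ x, e (k * x) = e x) (hestar : ∀ x, mulStar (⇑e) x = e x)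
    {χ : HeckeCharacter L} (hχu : χ.IsUnitary) (hoff : ¬ (χ * (reflectChar (IsCMField.complexConj L) χ)⁻¹).IsNormTwist) :
    ∀ W' : ClosedSubrep ((quasiSplit (↥(maximalRealSubfield L)) L (IsCMField.complexConj L) 2).rightRegular μ), W'.toContRep.IsTopIrreducible → W'.toSubmodule ≤ (resHBlock L μ ((standardMaximalCompactGL 2 L).comap (adelicVal (↥(maximalRealSubfield L)) L (IsCMField.complexConj L) 2 ((StdForm.antidiagonal 2).over L)) : Subgroup (quasiSplit (↥(maximalRealSubfield L)) L (IsCMField.complexConj L) 2).Adelic) 1 χ)ᗮ := by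
  obtain ⟨hKcK, hKinfKc, hU₀Kc, hK'U₀, hK'o, hU₀o, hU₀c⟩ := m1_level_witness L
  haveI : CompactSpace ↥((standardMaximalCompactGL 2 L).comap (adelicVal (↥(maximalRealSubfield L)) L (IsCMField.complexConj L) 2 ((StdForm.antidiagonal 2).over L)) : Subgroup (quasiSplit (↥(maximalRealSubfield L)) L (IsCMField.complexConj L) 2).Adelic) := isCompact_iff_compactSpace.1 isCompact_comap_adelicVal_standardMaximalCompactGL
  exact subrep_le_orthogonal_resHBlock_offDual_one L μ νinf νf μK χ₁ e hχ1 _ hK'o he0 he1 heK hestar (glFiniteIntegralLevel 2 L) hU₀o hU₀c hK'U₀ hKcK hKinfKc hU₀Kc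
    (haar : Measure ↥((standardMaximalCompactGL 2 L).comap (adelicVal (↥(maximalRealSubfield L)) L (IsCMField.complexConj L) 2 ((StdForm.antidiagonal 2).over L)) : Subgroup (quasiSplit (↥(maximalRealSubfield L)) L (IsCMField.complexConj L) 2).Adelic)) hχu hoff (hVc_maximalLevel_one L χ)

include νinf μK in
/-- **(N_blk) AT THE MAXIMAL LEVEL, `ω = 1`, OFF-DUAL `χ`, LETTER-LIGHT** — the `hN` bytes at `(K, 1, resHLine L μ U′ K 1 χ)` for every block-model map `U′`, visible only the measures, `χ₁ ≡ 1`
and `e`. [cite: MoeglinWaldspurger1995, IV.1.10, V.3.13, VI.2] -/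
theorem resH_isotypic_le_orthogonal_lines_offDual_maximalLevel [MeasurableMul (finAdelic (↥(maximalRealSubfield L)) L (IsCMField.complexConj L) 2 ((StdForm.antidiagonal 2).over L))] [ENNReal.HolderTriple ∞ 2 2] (hχ1 : ∀ k, χ₁ k = 1)
    (he0 : ∀ x, x ∉ ((glFiniteIntegralLevel 2 L).comap (finAdelic (↥(maximalRealSubfield L)) L (IsCMField.complexConj L) 2 ((StdForm.antidiagonal 2).over L)).subtype : Subgroup (finAdelic (↥(maximalRealSubfield L)) L (IsCMField.complexConj L) 2 ((StdForm.antidiagonal 2).over L))) → e x = 0) (he1 : ∫ x, e x ∂νf = 1)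
    (heK : ∀ k ∈ ((glFiniteIntegralLevel 2 L).comap (finAdelic (↥(maximalRealSubfield L)) L (IsCMField.complexConj L) 2 ((StdForm.antidiagonal 2).over L)).subtype : Subgroup (finAdelic (↥(maximalRealSubfield L)) L (IsCMField.complexConj L) 2 ((StdForm.antidiagonal 2).over L))), ∀ x, e (k * x) = e x) (hestar : ∀ x, mulStar (⇑e) x = e x)
    {χ : HeckeCharacter L} (hχu : χ.IsUnitary) (hoff : ¬ (χ * (reflectChar (IsCMField.complexConj L) χ)⁻¹).IsNormTwist)
    (𝔓 : (quasiSplit (↥(maximalRealSubfield L)) L (IsCMField.complexConj L) 2).ParabolicUnipotentData)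
    {A Λ : Type*} [AddCommGroup A] [Module ℂ A] [AddCommGroup Λ] [Module ℂ Λ] (U' : (quasiSplit (↥(maximalRealSubfield L)) L (IsCMField.complexConj L) 2).L2 μ →ₗ[ℂ] A × Λ) :
    ∀ W' : ClosedSubrep ((quasiSplit (↥(maximalRealSubfield L)) L (IsCMField.complexConj L) 2).rightRegular μ), W'.toContRep.IsTopIrreducible → W' ≤ residualSubspace (quasiSplit (↥(maximalRealSubfield L)) L (IsCMField.complexConj L) 2) μ 𝔓 →
      W'.toSubmodule ⊓ (⨅ k : ↥((standardMaximalCompactGL 2 L).comap (adelicVal (↥(maximalRealSubfield L)) L (IsCMField.complexConj L) 2 ((StdForm.antidiagonal 2).over L)) : Subgroup (quasiSplit (↥(maximalRealSubfield L)) L (IsCMField.complexConj L) 2).Adelic), Module.End.eigenspace ((((quasiSplit (↥(maximalRealSubfield L)) L (IsCMField.complexConj L) 2).rightRegular μ) ((((standardMaximalCompactGL 2 L).comap (adelicVal (↥(maximalRealSubfield L)) L (IsCMField.complexConj L) 2 ((StdForm.antidiagonal 2).over L)) : Subgroup (quasiSplit (↥(maximalRealSubfield L)) L (IsCMField.complexConj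 L) 2).Adelic)).subtype k) : (quasiSplit (↥(maximalRealSubfield L)) L (IsCMField.complexConj L) 2).L2 μ →L[ℂ] (quasiSplit (↥(maximalRealSubfield L)) L (IsCMField.complexConj L) 2).L2 μ) : (quasiSplit (↥(maximalRealSubfield L)) L (IsCMField.complexConj L) 2).L2 μ →ₗ[ℂ] (quasiSplit (↥(maximalRealSubfield L)) L (IsCMField.complexConj L) 2).L2 μ) ((1 : ↥((standardMaximalCompactGL 2 L).comap (adelicVal (↥(maximalRealSubfield L)) L (IsCMField.complexConj L) 2 ((StdForm.antidiagonal 2).over L)) : Subgroup (quasiSplit (↥(maximalRealSubfield L)) L (IsCMField.complexConj L) 2).Adelic) →* ℂ) k)) ≤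
        (resHLine L μ U' ((standardMaximalCompactGL 2 L).comap (adelicVal (↥(maximalRealSubfield L)) L (IsCMField.complexConj L) 2 ((StdForm.antidiagonal 2).over L)) : Subgroup (quasiSplit (↥(maximalRealSubfield L)) L (IsCMField.complexConj L) 2).Adelic) 1 χ)ᗮ := by
  intro W' hW' _
  exact inf_le_left.trans ((subrep_le_orthogonal_resHBlock_offDual_maximalLevel L μ νinf νf μK χ₁ e hχ1 he0 he1 heK hestar hχu hoff W' hW').trans
    (Submodule.orthogonal_le (resHLine_le_resHBlock L μ U' _ 1 χ)))

end Summit.HodgeConjecture.HodgeConjecture.R90.S8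

end
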